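import Mathlib
import Summits.MatrixMultiplication.MatrixMultiplication.Theorems.SnSubsetDichotomyPolynomialSlackHookCharacters

/-!
# The eight shapes of level `≤ 2`

Helper file for the LEVEL-TWO programme on the crux `SnSubsetDichotomy.PolynomialSlack`
(stmt-MatrixMultiplication-8306). The Wedderburn blocks of `ℂ[S_n]` of level `≤ 2` are indexed by
the partitions with a part `≥ n - 2` or with `≥ n - 2` parts; this file classifies them by their
sorted parts (pure combinatorics of `Nat.Partition`):

* `sortedParts_of_exists_part_ge_sub_two` — a partition of `d ≥ 4` with a part `≥ d - 2` has sorted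
  parts `[d]`, `[d-1, 1]`, `[d-2, 2]` or `[d-2, 1, 1]`;
* `sortedParts_of_card_parts_ge_sub_two` — a partition of `d ≥ 4` with `≥ d - 2` parts has sorted
  parts `1^d`, `2·1^{d-2}`, `2·2·1^{d-4}` or `3·1^{d-3}`;
* `sortedParts_transpose_of_eq_twoTwoColumn`, `sortedParts_transpose_of_eq_threeColumn` — the
  transposes of `2·2·1^{d-4}` and `3·1^{d-3}` are `[d-2, 2]` and `[d-2, 1, 1]`.

The level-one analogues are `sortedParts_of_exists_large_part`, `sortedParts_of_card_parts_ge`,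
`sortedParts_transpose_of_eq_replicate`, `sortedParts_transpose_of_eq_two_cons`
(file `…PolynomialSlackHookCharacters`).

References: W. Fulton, *Young Tableaux*, §0 (conjugate partitions); G. James, LNM 682, §3.
-/

namespace Summit.MatrixMultiplication.MatrixMultiplication.Theorems.PolynomialSlack

set_option linter.dupNamespace false

open Literature.NumberTheory.DiophantineGeometry Literature.RepresentationTheory.FiniteGroups

section Shapes

/-- A multiset of naturals all `≥ 1` whose sum exceeds its cardinality by one is a `2` together
with ones. [folklore] -/
theorem eq_cons_two_replicate_one_of_sum_eq_card_succ {s : Multiset ℕ} (h : ∀ a ∈ s, 1 ≤ a)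
    (hs : s.sum = s.card + 1) : s = 2 ::ₘ Multiset.replicate (s.card - 1) 1 := by
  -- not all elements are `1`
  have hex : ∃ a ∈ s, a ≠ 1 := by
    by_contra hall
    push Not at hall
    have hrep : s = Multiset.replicate s.card 1 := Multiset.eq_replicate.2 ⟨rfl, hall⟩
    rw [hrep, Multiset.sum_replicate, smul_eq_mul, mul_one, Multiset.card_replicate] at hs
    omega
  obtain ⟨a, ha, ha1⟩ := hex
  have ha2 : 2 ≤ a := by have := h a ha; omega
  obtain ⟨t, rfl⟩ := Multiset.exists_cons_of_mem ha
  rw [Multiset.sum_cons, Multiset.card_cons] at hs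
  have htpos : ∀ b ∈ t, 1 ≤ b := fun b hb => h b (Multiset.mem_cons_of_mem hb)
  have ht : t.card ≤ t.sum := card_le_sum_of_one_le htpos
  have ha' : a = 2 := by omega
  subst ha'
  have hts : t.sum = t.card := by omega
  rw [eq_replicate_one_of_sum_eq_card htpos hts, Multiset.card_cons, Multiset.card_replicate,
    Nat.add_sub_cancel]

/-- **Partitions with a part `≥ n - 2`** (`n ≥ 4`) are `(n)`, `(n-1, 1)`, `(n-2, 2)` or
`(n-2, 1, 1)`. [folklore] -/
theorem sortedParts_of_exists_part_ge_sub_two {d : ℕ} (μ : Nat.Partition d) (hd : 4 ≤ d) {a : ℕ}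
    (ha : a ∈ μ.parts) (hda : d ≤ a + 2) :
    μ.sortedParts = [d] ∨ μ.sortedParts = [d - 1, 1] ∨ μ.sortedParts = [d - 2, 2] ∨
      μ.sortedParts = [d - 2, 1, 1] := by
  by_cases hda1 : d ≤ a + 1
  · rcases sortedParts_of_exists_large_part μ ha hda1 with h | h
    · exact Or.inl h
    · exact Or.inr (Or.inl h)
  -- now `a = d - 2` and the other parts sum to `2`
  obtain ⟨t, ht⟩ := Multiset.exists_cons_of_mem ha
  have hsum : a + t.sum = d := by
    have := μ.parts_sum; rw [ht, Multiset.sum_cons] at this; exact this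
  have had : a = d - 2 := by omega
  have hts : t.sum = 2 := by omega
  have htpos : ∀ b ∈ t, 1 ≤ b := fun b hb => μ.parts_pos (by rw [ht]; exact Multiset.mem_cons_of_mem hb)
  have htcard : t.card ≤ t.sum := card_le_sum_of_one_le htpos
  by_cases hall : ∀ b ∈ t, b = 1
  · -- `t = {1, 1}`, `μ = (d-2, 1, 1)`
    right; right; right
    have hrep : t = Multiset.replicate t.card 1 := Multiset.eq_replicate.2 ⟨rfl, hall⟩
    have hc : t.card = 2 := by
      rw [hrep, Multiset.sum_replicate, smul_eq_mul, mul_one] at hts; exact hts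
    rw [hc] at hrep
    refine sortedParts_eq_of_parts_eq μ ?_ ?_
    · simp only [List.pairwise_cons, List.mem_cons, List.not_mem_nil, or_false, forall_eq_or_imp,
        forall_eq, List.Pairwise.nil, and_true, le_refl, IsEmpty.forall_iff, implies_true]
      omega
    · rw [ht, hrep, had]; rfl
  · -- `t = {2}`, `μ = (d-2, 2)`
    right; right; left
    push Not at hall
    obtain ⟨b, hb, hb1⟩ := hall
    have hb2 : 2 ≤ b := by have := htpos b hb; omega
    obtain ⟨u, rfl⟩ := Multiset.exists_cons_of_mem hb
    rw [Multiset.sum_cons] at hts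
    have hupos : ∀ c ∈ u, 1 ≤ c := fun c hc => htpos c (Multiset.mem_cons_of_mem hc)
    have hu : u.card ≤ u.sum := card_le_sum_of_one_le hupos
    have hb' : b = 2 := by omega
    subst hb'
    have hu0 : u = 0 := Multiset.card_eq_zero.1 (by omega)
    subst hu0
    refine sortedParts_eq_of_parts_eq μ ?_ ?_
    · simp only [List.pairwise_cons, List.mem_singleton, forall_eq, List.not_mem_nil,
        IsEmpty.forall_iff, implies_true, List.Pairwise.nil, and_true]
      omega
    · rw [ht, had]; rfl

/-- **Partitions with `≥ n - 2` parts** (`n ≥ 4`) are `(1ⁿ)`, `(2, 1^{n-2})`, `(2, 2, 1^{n-4})` or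
`(3, 1^{n-3})`. [folklore] -/
theorem sortedParts_of_card_parts_ge_sub_two {d : ℕ} (μ : Nat.Partition d) (hd : 4 ≤ d)
    (h : d ≤ μ.parts.card + 2) :
    μ.sortedParts = List.replicate d 1 ∨ μ.sortedParts = 2 :: List.replicate (d - 2) 1 ∨
      μ.sortedParts = 2 :: 2 :: List.replicate (d - 4) 1 ∨
        μ.sortedParts = 3 :: List.replicate (d - 3) 1 := by
  by_cases h1 : d ≤ μ.parts.card + 1
  · rcases sortedParts_of_card_parts_ge μ h1 with h' | h'
    · exact Or.inl h'
    · exact Or.inr (Or.inl h')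
  -- now `μ` has exactly `d - 2` parts
  have hcard : μ.parts.card = d - 2 := by omega
  have hpos : ∀ b ∈ μ.parts, 1 ≤ b := fun b hb => μ.parts_pos hb
  -- not all parts are `1`
  have hex : ∃ a ∈ μ.parts, a ≠ 1 := by
    by_contra hall
    push Not at hall
    have hrep : μ.parts = Multiset.replicate μ.parts.card 1 := Multiset.eq_replicate.2 ⟨rfl, hall⟩
    have := μ.parts_sum
    rw [hrep, Multiset.sum_replicate, smul_eq_mul, mul_one] at this
    omega
  obtain ⟨a, ha, ha1⟩ := hex
  have ha2 : 2 ≤ a := by have := hpos a ha; omega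
  obtain ⟨t, ht⟩ := Multiset.exists_cons_of_mem ha
  have hsum : a + t.sum = d := by
    have := μ.parts_sum; rw [ht, Multiset.sum_cons] at this; exact this
  have htpos : ∀ b ∈ t, 1 ≤ b := fun b hb => hpos b (by rw [ht]; exact Multiset.mem_cons_of_mem hb)
  have htcs : t.card ≤ t.sum := card_le_sum_of_one_le htpos
  have htc : t.card = d - 3 := by
    have : μ.parts.card = t.card + 1 := by rw [ht, Multiset.card_cons]
    omega
  rcases (show a = 2 ∨ a = 3 by omega) with rfl | rfl
  · -- `a = 2`: one more `2` among the other parts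
    right; right; left
    have hts : t.sum = t.card + 1 := by omega
    have htrep := eq_cons_two_replicate_one_of_sum_eq_card_succ htpos hts
    rw [htc, show d - 3 - 1 = d - 4 by omega] at htrep
    refine sortedParts_eq_of_parts_eq μ ?_ ?_
    · refine List.pairwise_cons.2 ⟨fun b hb => ?_, List.pairwise_cons.2 ⟨fun b hb => ?_,
        List.pairwise_replicate.2 (Or.inr le_rfl)⟩⟩
      · rcases List.mem_cons.1 hb with rfl | hb
        · exact le_rfl
        · rw [List.eq_of_mem_replicate hb]; omega
      · rw [List.eq_of_mem_replicate hb]; omega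
    · rw [ht, htrep, ← Multiset.cons_coe, ← Multiset.cons_coe, Multiset.coe_replicate]
  · -- `a = 3`: all other parts are `1`
    right; right; right
    have hts : t.sum = t.card := by omega
    have htrep := eq_replicate_one_of_sum_eq_card htpos hts
    rw [htc] at htrep
    refine sortedParts_eq_of_parts_eq μ ?_ ?_
    · refine List.pairwise_cons.2 ⟨fun b hb => ?_, List.pairwise_replicate.2 (Or.inr le_rfl)⟩
      rw [List.eq_of_mem_replicate hb]; omega
    · rw [ht, htrep, ← Multiset.cons_coe, Multiset.coe_replicate]

/-! ### The transposes of the two new column shapes -/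

/-- The transpose of `(2, 2, 1^{n-4})` is `(n-2, 2)` (`n ≥ 4`). [folklore] -/
theorem sortedParts_transpose_of_eq_twoTwoColumn {d : ℕ} (μ : Nat.Partition d) (hd : 4 ≤ d)
    (h : μ.sortedParts = 2 :: 2 :: List.replicate (d - 4) 1) :
    μ.transpose.sortedParts = [d - 2, 2] := by
  have hmem : ∀ i j : ℕ, (i, j) ∈ μ.youngDiagram ↔ (i < 2 ∧ j < 2) ∨ (2 ≤ i ∧ i < d - 2 ∧ j < 1) := by
    intro i j
    rw [mem_youngDiagram_of_sortedParts_eq μ h]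
    simp only [List.length_cons, List.length_replicate]
    constructor
    · rintro ⟨h1, h2⟩
      rcases Nat.lt_or_ge i 2 with hi | hi
      · left
        refine ⟨hi, ?_⟩
        rcases (show i = 0 ∨ i = 1 by omega) with rfl | rfl
        · simpa using h2
        · simpa using h2
      · right
        obtain ⟨k, rfl⟩ : ∃ k, i = k + 2 := ⟨i - 2, by omega⟩
        rw [List.getElem_cons_succ, List.getElem_cons_succ, List.getElem_replicate] at h2
        exact ⟨hi, by omega, h2⟩
    · rintro (⟨h1, h2⟩ | ⟨h1, h2, h3⟩)
      · rcases (show i = 0 ∨ i = 1 by omega) with rfl | rfl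
        · exact ⟨by omega, by simpa using h2⟩
        · exact ⟨by omega, by simpa using h2⟩
      · obtain ⟨k, rfl⟩ : ∃ k, i = k + 2 := ⟨i - 2, by omega⟩
        refine ⟨by omega, ?_⟩
        rw [List.getElem_cons_succ, List.getElem_cons_succ, List.getElem_replicate]; exact h3
  have hcol : ∀ j, μ.youngDiagram.colLen j = if j = 0 then d - 2 else if j = 1 then 2 else 0 := by
    intro j
    refine YoungDiagram.colLen_eq_of_forall_mem_iff fun i => ?_
    rw [hmem]
    split_ifs with h0 h1
    · subst h0; omega
    · subst h1; omega
    · omega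
  have hrow0 : μ.youngDiagram.rowLen 0 = 2 :=
    YoungDiagram.rowLen_eq_of_forall_mem_iff fun j => by rw [hmem]; omega
  rw [μ.sortedParts_transpose, YoungDiagram.rowLens, YoungDiagram.length_rowLens.symm.trans
    (by rw [YoungDiagram.length_rowLens, YoungDiagram.colLen_transpose, hrow0] :
      μ.youngDiagram.transpose.rowLens.length = 2)]
  simp [YoungDiagram.rowLen_transpose, hcol, List.range_succ]

/-- The transpose of `(3, 1^{n-3})` is `(n-2, 1, 1)` (`n ≥ 4`). [folklore] -/
theorem sortedParts_transpose_of_eq_threeColumn {d : ℕ} (μ : Nat.Partition d) (hd : 4 ≤ d)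
    (h : μ.sortedParts = 3 :: List.replicate (d - 3) 1) :
    μ.transpose.sortedParts = [d - 2, 1, 1] := by
  have hmem : ∀ i j : ℕ, (i, j) ∈ μ.youngDiagram ↔ (i = 0 ∧ j < 3) ∨ (1 ≤ i ∧ i < d - 2 ∧ j < 1) := by
    intro i j
    rw [mem_youngDiagram_of_sortedParts_eq μ h]
    simp only [List.length_cons, List.length_replicate]
    constructor
    · rintro ⟨h1, h2⟩
      rcases Nat.eq_zero_or_pos i with rfl | hi
      · left; exact ⟨rfl, by simpa using h2⟩
      · right
        obtain ⟨k, rfl⟩ : ∃ k, i = k + 1 := ⟨i - 1, by omega⟩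
        rw [List.getElem_cons_succ, List.getElem_replicate] at h2
        exact ⟨by omega, by omega, h2⟩
    · rintro (⟨rfl, h2⟩ | ⟨h1, h2, h3⟩)
      · exact ⟨by omega, by simpa using h2⟩
      · obtain ⟨k, rfl⟩ : ∃ k, i = k + 1 := ⟨i - 1, by omega⟩
        refine ⟨by omega, ?_⟩
        rw [List.getElem_cons_succ, List.getElem_replicate]; exact h3
  have hcol : ∀ j, μ.youngDiagram.colLen j =
      if j = 0 then d - 2 else if j = 1 then 1 else if j = 2 then 1 else 0 := by
    intro j
    refine YoungDiagram.colLen_eq_of_forall_mem_iff fun i => ?_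
    rw [hmem]
    split_ifs with h0 h1 h2
    · subst h0; omega
    · subst h1; omega
    · subst h2; omega
    · omega
  have hrow0 : μ.youngDiagram.rowLen 0 = 3 :=
    YoungDiagram.rowLen_eq_of_forall_mem_iff fun j => by rw [hmem]; omega
  rw [μ.sortedParts_transpose, YoungDiagram.rowLens, YoungDiagram.length_rowLens.symm.trans
    (by rw [YoungDiagram.length_rowLens, YoungDiagram.colLen_transpose, hrow0] :
      μ.youngDiagram.transpose.rowLens.length = 3)]
  simp [YoungDiagram.rowLen_transpose, hcol, List.range_succ]

end Shapes

end Summit.MatrixMultiplication.MatrixMultiplication.Theorems.PolynomialSlack
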